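import Literature.MathematicalPhysics.QuantumFieldTheory.Balaban1983to89.B10Eq18SigmaSU2Haar
import Literature.MathematicalPhysics.QuantumFieldTheory.Balaban1983to89.T4ExpWindowSmallField
import Mathlib
import HarnessLib

/-!
# TASK T-S5/U5.4j «Pauli chart comparison» — the quaternion metric of orbit localisation (T-S5.3) versus the Pauli-coordinate ball of the
# Laplace integral (T-S5.4) (planner ym-idea-2 g17, 2026-08-29T17:16:47Z) — step (1b) of the comparison stubs S5 (LINE-19
# ⟨stmt-QuantumFields-24004⟩/⟨24335⟩) and U5 (LINE-20 ⟨24336⟩)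

Free-hands work of width seat `ym-line-sfw-p2-w3` (g39, cell `ym-idea-1`).  For `A ∈ ℝ³` with `|A| ≤ π`:

  `(2/π)·|A| ≤ ‖q(exp iA) − 1‖ ≤ |A|`,  indeed `‖q(exp iA) − 1‖ = 2 sin(|A|/2)`,

where `q = su2Quat` is the tree's first-row quaternion of an `SU(2)` matrix and `exp iA = expPauli A` print's chart.  Proof: `expPauli = expPoint ∘ rev`
(✓`expPauli_eq_expPoint`), `su2Quat (expPoint x) = exp (imQuat x)` (✓`su2Quat_expPoint`) and the tree's
✓`T4ExpWindowSmallField.norm_exp_imQuat_sub_one` (`‖exp(ι x) − 1‖ = 2|sin(‖x‖/2)|`); then Jordan's inequality (`Real.mul_le_sin`) and `Real.sin_le`.  The Prop `PauliChartComparison` is the planner's text VERBATIM.  Mathlib + tree only; no `sorry`.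

HONEST LABEL: an S–M brick of step (1b); T-S5.4 proper, S5, U5, ⟨24004⟩ ⟨24335⟩ ⟨24336⟩ remain OPEN; no crux, rung or summit is proved; the
Yang–Mills mass gap is NOT proved by this file.
-/

set_option autoImplicit false

noncomputable section

open Real
open scoped Quaternion
open Literature.MathematicalPhysics.QuantumLattice (su2Quat)
open Literature.MathematicalPhysics.QuantumFieldTheory.Balaban1983to89.B10Eq18SigmaSU2Haar (expPauli rev norm_rev expPauli_eq_expPoint)
open Literature.MathematicalPhysics.QuantumFieldTheory.Balaban1983to89.T4HaarSU2ExpChart (imQuat expPoint su2Quat_expPoint)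
open Literature.MathematicalPhysics.QuantumFieldTheory.Balaban1983to89.T4ExpWindowSmallField (norm_exp_imQuat_sub_one)

namespace Summit.QuantumFields.YangMills.Theorems.AllWindowsColdBoxBoxHighLine

/-- T-S5.4j **(Pauli chart comparison; S–M)**: for `|A| ≤ π`, `(2/π)|A| ≤ ‖q(exp iA) − 1‖ ≤ |A|`
(planner ym-idea-2 g17, 2026-08-29T17:16:47Z, verbatim). -/
def PauliChartComparison : Prop :=
  ∀ A : EuclideanSpace ℝ (Fin 3), ‖A‖ ≤ Real.pi →
    2 / Real.pi * ‖A‖ ≤ ‖su2Quat (expPauli A) - 1‖ ∧ ‖su2Quat (expPauli A) - 1‖ ≤ ‖A‖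

/-- **`‖q(exp iA) − 1‖ = 2 sin(|A|/2)`** for `|A| ≤ π`. -/
theorem norm_su2Quat_expPauli_sub_one (A : EuclideanSpace ℝ (Fin 3)) (hA : ‖A‖ ≤ Real.pi) :
    ‖su2Quat (expPauli A) - 1‖ = 2 * Real.sin (‖A‖ / 2) := by
  rw [expPauli_eq_expPoint, su2Quat_expPoint, norm_exp_imQuat_sub_one, norm_rev,
    abs_of_nonneg (Real.sin_nonneg_of_nonneg_of_le_pi (by positivity) (by linarith [Real.pi_pos]))]

/-- ★ **T-S5.4j «PAULI CHART COMPARISON», BY NAME.** [folklore] -/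
theorem pauliChartComparison : PauliChartComparison := by
  intro A hA
  rw [norm_su2Quat_expPauli_sub_one A hA]
  have h0 : 0 ≤ ‖A‖ / 2 := by positivity
  have h1 : ‖A‖ / 2 ≤ Real.pi / 2 := by linarith
  constructor
  · have := Real.mul_le_sin h0 h1
    have e : 2 / Real.pi * ‖A‖ = 2 * (2 / Real.pi * (‖A‖ / 2)) := by ring
    rw [e]
    linarith
  · have := Real.sin_le h0
    linarith

end Summit.QuantumFields.YangMills.Theorems.AllWindowsColdBoxBoxHighLine

end
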